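import Summits.ResolutionOfSingularities.ResolutionOfSingularities.Theorems.PurelyInseparableDim4SpivakovskyDefs
import HarnessLib

/-!
# [OURS · res-dim4-pi PR-9c, part 2] Spivakovsky's strategy is PERMISSIBLE (Lemma 1 (a) ⇒ (b) and the Corollary)

Cell `res-dim4-pi` (D-0157 DOOR 2), brick **PR-9c / NEED-FACT «Spivakovsky 1983»** (desk WORD #24 (a), #25 (e);
seat `res-dim4-p-11`, lead of the PR-9c consortium).  Def-free sequel of `…SpivakovskyDefs`.  Source:
M. Spivakovsky, *A solution to Hironaka's polyhedra game*, Arithmetic and Geometry II (Progr. Math. 36, 1983)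
419–432, §II (the strategy) and §III Lemma 1, Corollary [cite: Spivakovsky1983, §II, §III Lemma 1 and Corollary].

* `minPerm_spec`, `not_perm_of_ssubset_minPerm`: the least-cardinality permissible subset is permissible and
  minimal for inclusion; `perm_self_of_one_le_dG`: `I` is permissible when `d(G) ≥ 1`;
* `stratFuel_eq_of_card_le` (fuel irrelevance), `strat_eq_union` / `strat_eq_Sset` / `strat_eq_minPerm`: the three
  branches of the positional strategy `strat I G = S(G) ∪ strat I₁ G₁ | S(G) | minPerm`, `Sset_subset_strat`;
* **Lemma 1 (a) ⇒ (b)**: `one_le_sum_union_of_perm_derive` (Γ₁ permissible for G₁ ⇒ `S(G) ∪ Γ₁` satisfies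
  `Σ_Γ g ≥ 1` on `G`) and `dt_le_sum_union_tilde` (`d_Γ(G̃) = d(G̃)`);
* **Corollary** `strat_spec` / `strat_subset` / `perm_strat` / `dt_le_sum_strat_tilde`: at every good position with
  `d(G) ≥ 1` the strategy is inside `I`, non-empty and permissible, and `d_{strat}(G̃) = d(G̃)` (induction on `#I`).

[OURS · counted 0 · AI work weaker than expert review] Kernel transcription of a 1983 combinatorial theorem used by
OUR frame's spine game; NOTHING here is a theorem about resolution of singularities in dimension ≥ 4 / characteristic
`p`. bears_on: LADDER-RESOLUTION:D157-DOOR2 (res-dim4-pi · PR-9c). Supports stmt-ResolutionOfSingularities-16155 (helper).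
-/

set_option linter.dupNamespace false -- mandated namespace of this single-conjunct summit

open Finset
open scoped BigOperators

namespace Summit.ResolutionOfSingularities.ResolutionOfSingularities.Theorems.PIDim4

namespace Spivakovsky

variable {σ : Type} [Fintype σ] [DecidableEq σ]

/-! ## §3 The minimal permissible set, the strategy, Lemma 1 (a) ⇒ (b) and the Corollary -/

section Strategy

variable {I : Finset σ} {G : Pos σ}

/-- `minPerm I G ⊆ I`, and if some `Γ ⊆ I` is permissible then `minPerm I G` is permissible of least
cardinality. [folklore] -/
theorem minPerm_spec (h : ∃ Γ ⊆ I, Perm Γ G) :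
    minPerm I G ⊆ I ∧ Perm (minPerm I G) G ∧
      ∀ Γ ⊆ I, Perm Γ G → (minPerm I G).card ≤ Γ.card := by
  classical
  have hne : (I.powerset.filter (fun Γ => Perm Γ G)).Nonempty := by
    obtain ⟨Γ, hΓ, hP⟩ := h
    exact ⟨Γ, Finset.mem_filter.mpr ⟨Finset.mem_powerset.mpr hΓ, hP⟩⟩
  have hdef : minPerm I G = Classical.choose (Finset.exists_min_image _ Finset.card hne) := by
    unfold minPerm
    rw [dif_pos hne]
  have hspec := Classical.choose_spec (Finset.exists_min_image _ Finset.card hne)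
  rw [← hdef] at hspec
  obtain ⟨hmem, hmin⟩ := hspec
  obtain ⟨hpow, hperm⟩ := Finset.mem_filter.mp hmem
  exact ⟨Finset.mem_powerset.mp hpow, hperm,
    fun Γ hΓ hP => hmin Γ (Finset.mem_filter.mpr ⟨Finset.mem_powerset.mpr hΓ, hP⟩)⟩

/-- `minPerm I G ⊆ I` unconditionally. [folklore] -/
theorem minPerm_subset : minPerm I G ⊆ I := by
  classical
  by_cases h : ∃ Γ ⊆ I, Perm Γ G
  · exact (minPerm_spec h).1
  · have hne : ¬ (I.powerset.filter (fun Γ => Perm Γ G)).Nonempty := by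
      rintro ⟨Γ, hΓ⟩
      obtain ⟨hpow, hperm⟩ := Finset.mem_filter.mp hΓ
      exact h ⟨Γ, Finset.mem_powerset.mp hpow, hperm⟩
    unfold minPerm
    rw [dif_neg hne]
    exact Finset.empty_subset _

/-- Minimality for inclusion: no proper subset of `minPerm I G` is permissible. [folklore] -/
theorem not_perm_of_ssubset_minPerm (h : ∃ Γ ⊆ I, Perm Γ G) {Γ' : Finset σ} (hss : Γ' ⊂ minPerm I G) :
    ¬ Perm Γ' G := fun hP =>
  absurd ((minPerm_spec h).2.2 Γ' (hss.1.trans (minPerm_spec h).1) hP)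
    (not_le.mpr (Finset.card_lt_card hss))

/-- `I` itself is permissible when `d(G) ≥ 1` (so a minimal permissible subset exists). [folklore] -/
theorem perm_self_of_one_le_dG (hG : G.Nonempty) (hd : 1 ≤ dG I G) : Perm I G := by
  refine ⟨?_, fun g hg => hd.trans (dG_le I hg)⟩
  by_contra hI
  rw [Finset.not_nonempty_iff_eq_empty] at hI
  subst hI
  obtain ⟨g, hg, hgd⟩ := exists_dG_eq (∅ : Finset σ) hG
  rw [Finset.sum_empty] at hgd
  linarith

/-- Fuel above `#I` does not matter. [folklore] -/
theorem stratFuel_eq_of_card_le : ∀ (n m : ℕ) (I : Finset σ) (G : Pos σ), G.Nonempty ∨ G = ∅ →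
    I.card ≤ n → I.card ≤ m → stratFuel n I G = stratFuel m I G := by
  intro n
  induction n with
  | zero =>
    intro m I G _ hn hm
    have hI : I = ∅ := Finset.card_eq_zero.mp (Nat.le_zero.mp hn)
    subst hI
    cases m with
    | zero => rfl
    | succ m =>
      have hdt : dt (∅ : Finset σ) G = 0 := by
        unfold dt dG
        split_ifs with h
        · simp
        · rfl
      simp [stratFuel, hdt]
  | succ n ih =>
    intro m I G hG hn hm
    cases m with
    | zero =>
      have hI : I = ∅ := Finset.card_eq_zero.mp (Nat.le_zero.mp hm)
      subst hI
      have hdt : dt (∅ : Finset σ) G = 0 := by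
        unfold dt dG
        split_ifs with h
        · simp
        · rfl
      simp [stratFuel, hdt]
    | succ m =>
      simp only [stratFuel]
      by_cases hdt : dt I G = 0
      · simp [hdt]
      · simp only [hdt, ↓reduceIte]
        by_cases hder : derive I G = ∅
        · simp [hder]
        · simp only [hder, ↓reduceIte]
          congr 1
          have hGne : G.Nonempty := by
            rcases hG with hG | hG
            · exact hG
            · exfalso; apply hdt; subst hG; unfold dt dG tilde; simp
          -- `S(G)` is non-empty, so `#I₁ < #I`
          have hS : (Sset I G).Nonempty := by
            by_contra hS
            rw [Finset.not_nonempty_iff_eq_empty] at hS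
            apply hdt
            -- if `S(G) = ∅` every minimiser equals `ω` on `I`; use the characterisation through a minimiser
            obtain ⟨w, hw, hwd⟩ := exists_dG_eq I hGne
            have hwk : ∀ k ∈ I, w k = omega G k := fun k hk => by
              by_contra hne
              have : k ∈ Sset I G := mem_Sset_iff.mpr ⟨hk, w, hw, hwd, hne⟩
              rw [hS] at this
              exact Finset.notMem_empty _ this
            apply le_antisymm _ (dt_nonneg I hGne)
            calc dt I G ≤ ∑ k ∈ I, (w - omega G) k := dG_le I (sub_omega_mem_tilde hw)
              _ = 0 := Finset.sum_eq_zero fun k hk => by simp [hwk k hk]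
          have hlt : (I1 I G).card < I.card := by
            obtain ⟨j, hj⟩ := hS
            exact Finset.card_lt_card ⟨I1_subset, fun h => (mem_I1_iff.mp (h (Sset_subset hj))).2 hj⟩
          have hder' : (derive I G).Nonempty ∨ derive I G = ∅ := by
            rcases (derive I G).eq_empty_or_nonempty with h | h
            · exact Or.inr h
            · exact Or.inl h
          exact ih m (I1 I G) (derive I G) hder' (by omega) (by omega)

/-- **The strategy unfolds one level**: `strat I G = S(G) ∪ strat I₁ G₁` when `d(G̃) ≠ 0` and `G₁ ≠ ∅`.
[cite: Spivakovsky1983, §II] -/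
theorem strat_eq_union (hgood : Good I G) (hdt : dt I G ≠ 0) (hne : (derive I G).Nonempty) :
    strat I G = Sset I G ∪ strat (I1 I G) (derive I G) := by
  have hlt := card_I1_lt hgood hdt
  obtain ⟨n, hn⟩ : ∃ n, I.card = n + 1 := Nat.exists_eq_add_one.mpr (by omega)
  unfold strat
  rw [hn]
  simp only [stratFuel, hdt, ↓reduceIte, Finset.nonempty_iff_ne_empty.mp hne]
  congr 1
  exact stratFuel_eq_of_card_le n _ _ _ (Or.inl hne) (by omega) le_rfl

/-- `strat I G = S(G)` when `d(G̃) ≠ 0` and `G₁ = ∅`. [cite: Spivakovsky1983, §II (case Δ_r = ∅)] -/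
theorem strat_eq_Sset (hgood : Good I G) (hdt : dt I G ≠ 0) (he : derive I G = ∅) :
    strat I G = Sset I G := by
  have hlt := card_I1_lt hgood hdt
  obtain ⟨n, hn⟩ : ∃ n, I.card = n + 1 := Nat.exists_eq_add_one.mpr (by omega)
  unfold strat
  rw [hn]
  simp [stratFuel, hdt, he]

/-- `strat I G = minPerm I G` when `d(G̃) = 0` (one-vertex case). [cite: Spivakovsky1983, §II, Lemma 3] -/
theorem strat_eq_minPerm (hdt : dt I G = 0) : strat I G = minPerm I G := by
  unfold strat
  cases hI : I.card with
  | zero => rfl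
  | succ n => simp [stratFuel, hdt]

/-- `S(G) ⊆ strat I G` whenever `d(G̃) ≠ 0`. [cite: Spivakovsky1983, §II] -/
theorem Sset_subset_strat (hgood : Good I G) (hdt : dt I G ≠ 0) : Sset I G ⊆ strat I G := by
  rcases (derive I G).eq_empty_or_nonempty with he | hne
  · rw [strat_eq_Sset hgood hdt he]
  · rw [strat_eq_union hgood hdt hne]
    exact Finset.subset_union_left

/-- **Lemma 1, (a) ⇒ (b), first half**: if `Γ₁ ⊆ I₁` is permissible for `G₁` (or `G₁ = ∅` and `Γ₁ = ∅`),
then `Γ = S(G) ∪ Γ₁` satisfies `Σ_Γ g ≥ 1` on `G`. [cite: Spivakovsky1983, §III Lemma 1] -/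
theorem one_le_sum_union_of_perm_derive (hgood : Good I G) {Γ₁ : Finset σ} (hΓ₁ : Γ₁ ⊆ I1 I G)
    (hP : ∀ y ∈ derive I G, 1 ≤ ∑ j ∈ Γ₁, y j) {g : σ → ℚ} (hg : g ∈ G) :
    1 ≤ ∑ j ∈ Sset I G ∪ Γ₁, g j := by
  have hdisj : Disjoint (Sset I G) Γ₁ :=
    Finset.disjoint_left.mpr fun k hkS hkΓ => (mem_I1_iff.mp (hΓ₁ hkΓ)).2 hkS
  rw [Finset.sum_union hdisj]
  by_cases hlt : ∑ j ∈ Sset I G, g j < 1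
  · -- `g` itself passes the filter: `P_S(g) ∈ G₁`
    have hy := hP _ (proj_mem_derive (mem_Hset_of_mem hg) hlt)
    have hden : 0 < 1 - ∑ j ∈ Sset I G, g j := by linarith
    have hsum : ∑ j ∈ Γ₁, proj (Sset I G) (I1 I G) g j = (∑ j ∈ Γ₁, g j) / (1 - ∑ j ∈ Sset I G, g j) := by
      rw [Finset.sum_div]
      exact Finset.sum_congr rfl fun k hk => proj_apply_of_mem (hΓ₁ hk) g
    rw [hsum, le_div_iff₀ hden] at hy
    linarith
  · push Not at hlt
    have h0 : 0 ≤ ∑ j ∈ Γ₁, g j := Finset.sum_nonneg fun k _ => hgood.2.1 g hg k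
    linarith

/-- **Lemma 1, (a) ⇒ (b), second half**: with `Γ` as above, `d_Γ(G̃) = d(G̃)`, stated as the non-trivial
inequality `Σ_Γ g̃ ≥ d(G̃)` for every generator. [cite: Spivakovsky1983, §III Lemma 1] -/
theorem dt_le_sum_union_tilde (hgood : Good I G) (hdt : dt I G ≠ 0) {Γ₁ : Finset σ} (hΓ₁ : Γ₁ ⊆ I1 I G)
    (hP : ∀ y ∈ derive I G, 1 ≤ ∑ j ∈ Γ₁, y j) {g : σ → ℚ} (hg : g ∈ G) :
    dt I G ≤ ∑ j ∈ Sset I G ∪ Γ₁, (g - omega G) j := by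
  have hpos : 0 < dt I G := lt_of_le_of_ne (dt_nonneg I hgood.1) (Ne.symm hdt)
  have hdisj : Disjoint (Sset I G) Γ₁ :=
    Finset.disjoint_left.mpr fun k hkS hkΓ => (mem_I1_iff.mp (hΓ₁ hkΓ)).2 hkS
  set h : σ → ℚ := (dt I G)⁻¹ • (g - omega G) with hh
  have hH : h ∈ Hset I G := smul_tilde_mem_Hset hg
  have hscale : ∀ T : Finset σ, ∑ j ∈ T, h j = (∑ j ∈ T, (g - omega G) j) / dt I G := fun T => by
    simp only [hh, Pi.smul_apply, smul_eq_mul, inv_mul_eq_div, Finset.sum_div]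
  rw [Finset.sum_union hdisj]
  by_cases hlt : ∑ j ∈ Sset I G, h j < 1
  · have hy := hP _ (proj_mem_derive hH hlt)
    have hden : 0 < 1 - ∑ j ∈ Sset I G, h j := by linarith
    have hsum : ∑ j ∈ Γ₁, proj (Sset I G) (I1 I G) h j = (∑ j ∈ Γ₁, h j) / (1 - ∑ j ∈ Sset I G, h j) := by
      rw [Finset.sum_div]
      exact Finset.sum_congr rfl fun k hk => proj_apply_of_mem (hΓ₁ hk) h
    rw [hsum, le_div_iff₀ hden, one_mul] at hy
    have hboth : 1 ≤ ∑ j ∈ Sset I G, h j + ∑ j ∈ Γ₁, h j := by linarith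
    rw [hscale, hscale, ← add_div, le_div_iff₀ hpos, one_mul] at hboth
    exact hboth
  · push Not at hlt
    rw [hscale, le_div_iff₀ hpos, one_mul] at hlt
    have h0 : 0 ≤ ∑ j ∈ Γ₁, (g - omega G) j :=
      Finset.sum_nonneg fun k _ => tilde_nonneg (sub_omega_mem_tilde hg) k
    linarith

/-- **Corollary (Spivakovsky §III): the strategy is permissible**, non-empty and inside `I`, at every good
position with `d(G) ≥ 1`; moreover `d_Γ(G̃) = d(G̃)` for `Γ = strat I G` when `d(G̃) ≠ 0`.
[cite: Spivakovsky1983, §III Corollary] -/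
theorem strat_spec : ∀ (n : ℕ) (I : Finset σ) (G : Pos σ), I.card ≤ n → Good I G → 1 ≤ dG I G →
    strat I G ⊆ I ∧ Perm (strat I G) G ∧
      (dt I G ≠ 0 → ∀ g ∈ G, dt I G ≤ ∑ j ∈ strat I G, (g - omega G) j) := by
  intro n
  induction n with
  | zero =>
    intro I G hn hgood hd
    have hI : I = ∅ := Finset.card_eq_zero.mp (Nat.le_zero.mp hn)
    exfalso
    subst hI
    obtain ⟨g, hg, hgd⟩ := exists_dG_eq (∅ : Finset σ) hgood.1
    rw [Finset.sum_empty] at hgd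
    linarith
  | succ n ih =>
    intro I G hn hgood hd
    by_cases hdt : dt I G = 0
    · have hex : ∃ Γ ⊆ I, Perm Γ G := ⟨I, le_rfl, perm_self_of_one_le_dG hgood.1 hd⟩
      rw [strat_eq_minPerm hdt]
      exact ⟨(minPerm_spec hex).1, (minPerm_spec hex).2.1, fun h => absurd hdt h⟩
    · rcases (derive I G).eq_empty_or_nonempty with he | hne
      · -- `G₁ = ∅`: `Γ = S(G)`
        rw [strat_eq_Sset hgood hdt he]
        have hP : ∀ y ∈ derive I G, 1 ≤ ∑ j ∈ (∅ : Finset σ), y j := by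
          intro y hy; rw [he] at hy; exact absurd hy (Finset.notMem_empty _)
        have h1 := fun g (hg : g ∈ G) =>
          one_le_sum_union_of_perm_derive hgood (Finset.empty_subset _) hP hg
        have h2 := fun g (hg : g ∈ G) =>
          dt_le_sum_union_tilde hgood hdt (Finset.empty_subset _) hP hg
        simp only [Finset.union_empty] at h1 h2
        exact ⟨Sset_subset, ⟨Sset_nonempty hgood hdt, h1⟩, fun _ => h2⟩
      · -- `G₁ ≠ ∅`: `Γ = S(G) ∪ strat I₁ G₁`, induction hypothesis on `I₁`
        have hlt := card_I1_lt hgood hdt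
        obtain ⟨hsub₁, hperm₁, -⟩ := ih (I1 I G) (derive I G) (by omega) (good_derive hgood hne)
          (one_le_dG_derive hgood hd hdt hne)
        rw [strat_eq_union hgood hdt hne]
        refine ⟨Finset.union_subset Sset_subset (hsub₁.trans I1_subset),
          ⟨(Sset_nonempty hgood hdt).mono Finset.subset_union_left,
            fun g hg => one_le_sum_union_of_perm_derive hgood hsub₁ hperm₁.2 hg⟩,
          fun _ g hg => dt_le_sum_union_tilde hgood hdt hsub₁ hperm₁.2 hg⟩

/-- The strategy stays inside `I`. [cite: Spivakovsky1983, §II] -/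
theorem strat_subset (hgood : Good I G) (hd : 1 ≤ dG I G) : strat I G ⊆ I :=
  (strat_spec I.card I G le_rfl hgood hd).1

/-- **The strategy is permissible.** [cite: Spivakovsky1983, §III Corollary] -/
theorem perm_strat (hgood : Good I G) (hd : 1 ≤ dG I G) : Perm (strat I G) G :=
  (strat_spec I.card I G le_rfl hgood hd).2.1

/-- `d_Γ(G̃) = d(G̃)` for the strategy's `Γ` (the equality half of Lemma 1 (b), used in Lemma 2).
[cite: Spivakovsky1983, §III Lemma 1, Lemma 2 (1)] -/
theorem dt_le_sum_strat_tilde (hgood : Good I G) (hd : 1 ≤ dG I G) (hdt : dt I G ≠ 0) {g : σ → ℚ}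
    (hg : g ∈ G) : dt I G ≤ ∑ j ∈ strat I G, (g - omega G) j :=
  (strat_spec I.card I G le_rfl hgood hd).2.2 hdt g hg

end Strategy

end Spivakovsky

end Summit.ResolutionOfSingularities.ResolutionOfSingularities.Theorems.PIDim4
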